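import Mathlib
import Summits.Ventures.HodgeRepro.Tier4.Common.AdelicDefs
import Summits.Ventures.HodgeRepro.Tier4.Common.AdelicPlaces
import Summits.Ventures.HodgeRepro.Tier4.Common.CongruenceAdeles
import Summits.Ventures.HodgeRepro.Tier4.Common.CompactOpenLevel
import Summits.Ventures.HodgeRepro.Tier4.Line1.AdelicParts
import Summits.Ventures.HodgeRepro.Tier4.Line1.FiniteLevelIsolation

/-!
# Tier4/Line4/TransporterLocal — the local (one finite place) toolkit for C-L4-TRANSPORTER-SEP

Blind re-derivation cell `pub-hodge-repro`, Tier 4 (README §9–§10), seat t4-L2-p3 (gen 4), cut C-L4-TRANSPORTER-SEP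
(plan-4 g5 S15186 (2), statement S15285).  Tree path `lean/Summits/Ventures/HodgeRepro/Tier4/Line4/TransporterLocal.lean`.

WHAT: the only piece of `q`-adic topology the separation lemma needs, in the weakest form: at a finite place `v` of `k`
with `|q|_v < 1`, a continuous matrix expression in four `4 × 4` variables over `k_v` which is non-zero at `(1, 1, 1, 1)`
stays non-zero when each variable is entrywise within `|q|_v ^ n` of `1`, for every `n ≥ n₀` (`exists_nat_ne_zero_of_nearQuad`).
This is «the congruence subgroups `K_v(q^n)` form a neighbourhood basis of `1`» without ever topologising `GL₄(k_v)`: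
* `exists_nat_forall_near_of_mem_nhds`: the generic finite-product step (`nhds_pi` + a finite `sup` of thresholds);
* `exists_nat_ball_subset_of_mem_nhds`: in `k_v` the closed balls of radius `ε ^ n` (`0 < ε < 1`) eventually enter any
  neighbourhood (`Valued.mem_nhds`);
* `exists_nat_nearMat_subset_of_mem_nhds`, `exists_nat_nearQuad_subset_of_mem_nhds`: the matrix and the
  four-matrix versions;
* `exists_heightOneSpectrum_natCast_mem`, `natSize_lt_one_of_mem`: a prime `q` lies in some finite place `v` of `k`
  (lying over, `ℤ → 𝓞_k`), where `|q|_v < 1`;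
* `finiteComponent_coe`, `finiteComponent_eq_of_finM_eq`, `finiteComponent_ofFinPart`,
  `nearMat_finiteComponent_of_mem_levelK`: the `v`-component (typer-2's `GA.finiteComponent`) depends only on the finite
  part of the adelic matrix, is unchanged by `GA.ofFinPart`, and for `a ∈ K(N)` its entries are within `|N|_v` of `1`.
No printed input is consumed.  HC_CM is NOT proved by anyone in this repository.
-/

set_option autoImplicit false

noncomputable section

namespace Summit.Ventures.HodgeRepro.Tier4.Line4

open Summit.Ventures.HodgeRepro.Tier4 Summit.Ventures.HodgeRepro.Tier4.Common
  Summit.Ventures.HodgeRepro.Tier4.Line1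
open NumberField IsDedekindDomain Topology Filter Matrix
open scoped NumberField

/-! ### 1. Uniform balls in a finite product -/

section Pi

/-- **The finite-product step**: if in every factor the `n`-th balls (`near i n · x`) eventually enter any
neighbourhood of `x`, the same holds for the product with the product balls (threshold = the finite `sup`). -/
theorem exists_nat_forall_near_of_mem_nhds {ι : Type} [Fintype ι] {X : ι → Type} [∀ i, TopologicalSpace (X i)]
    (near : ∀ i, ℕ → X i → X i → Prop)
    (hball : ∀ i (x : X i) (s : Set (X i)), s ∈ 𝓝 x → ∃ n₀ : ℕ, ∀ n ≥ n₀, ∀ y, near i n y x → y ∈ s)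
    (x : ∀ i, X i) (s : Set (∀ i, X i)) (hs : s ∈ 𝓝 x) :
    ∃ n₀ : ℕ, ∀ n ≥ n₀, ∀ y : ∀ i, X i, (∀ i, near i n (y i) (x i)) → y ∈ s := by
  rw [nhds_pi, Filter.mem_pi] at hs
  obtain ⟨I, -, t, ht, hts⟩ := hs
  choose n₀ hn₀ using fun i => hball i (x i) (t i) (ht i)
  refine ⟨Finset.univ.sup n₀, fun n hn y hy => hts ?_⟩
  rw [Set.mem_pi]
  intro i _
  exact hn₀ i n (le_trans (Finset.le_sup (Finset.mem_univ i)) hn) (y i) (hy i)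

end Pi

/-! ### 2. Balls in `k_v` and in matrices over `k_v` -/

section Ball

variable {k : Type} [Field k] [NumberField k] (v : HeightOneSpectrum (𝓞 k))

/-- In `k_v`, the closed balls of radius `ε ^ n` around `x` (`0 < ε < 1` fixed) eventually sit inside any
neighbourhood of `x`. -/
theorem exists_nat_ball_subset_of_mem_nhds {ε : WithZero (Multiplicative ℤ)} (hε0 : ε ≠ 0) (hε1 : ε < 1)
    (x : v.adicCompletion k) (s : Set (v.adicCompletion k)) (hs : s ∈ 𝓝 x) :
    ∃ n₀ : ℕ, ∀ n ≥ n₀, ∀ y : v.adicCompletion k, Valued.v (y - x) ≤ ε ^ n → y ∈ s := by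
  obtain ⟨γ, hγ⟩ := Valued.mem_nhds.1 hs
  have hγ0 : MonoidWithZeroHom.ValueGroup₀.embedding (γ.1) ≠ 0 :=
    MonoidWithZeroHom.ValueGroup₀.embedding_unit_ne_zero γ
  obtain ⟨u, hu⟩ := WithZero.ne_zero_iff_exists.1 hε0
  have hu1 : u < 1 := by rw [← hu, ← WithZero.coe_one, WithZero.coe_lt_coe] at hε1; exact hε1
  obtain ⟨w, hw⟩ := WithZero.ne_zero_iff_exists.1 hγ0
  obtain ⟨n₀, hn₀⟩ := exists_pow_lt hu1 w
  refine ⟨n₀, fun n hn y hy => hγ ?_⟩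
  show Valued.v.restrict (y - x) < γ.1
  rw [Valuation.restrict_lt_iff_lt_embedding]
  refine lt_of_le_of_lt hy ?_
  rw [← hu, ← hw, ← WithZero.coe_pow, WithZero.coe_lt_coe]
  exact lt_of_le_of_lt (pow_le_pow_right_of_le_one' hu1.le hn) hn₀

/-- The matrix version of `exists_nat_ball_subset_of_mem_nhds` (two finite-product steps). -/
theorem exists_nat_nearMat_subset_of_mem_nhds {ε : WithZero (Multiplicative ℤ)} (hε0 : ε ≠ 0) (hε1 : ε < 1)
    (x : Matrix (Fin 4) (Fin 4) (v.adicCompletion k)) (s : Set (Matrix (Fin 4) (Fin 4) (v.adicCompletion k)))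
    (hs : s ∈ 𝓝 x) : ∃ n₀ : ℕ, ∀ n ≥ n₀, ∀ y, (∀ i j, Valued.v (y i j - x i j) ≤ ε ^ n) → y ∈ s := by
  have hrow : ∀ (x : Fin 4 → v.adicCompletion k) (s : Set (Fin 4 → v.adicCompletion k)), s ∈ 𝓝 x →
      ∃ n₀ : ℕ, ∀ n ≥ n₀, ∀ y, (∀ j, Valued.v (y j - x j) ≤ ε ^ n) → y ∈ s := fun x s hs =>
    exists_nat_forall_near_of_mem_nhds (fun _ n y x => Valued.v (y - x) ≤ ε ^ n)
      (fun _ => exists_nat_ball_subset_of_mem_nhds v hε0 hε1) x s hs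
  exact exists_nat_forall_near_of_mem_nhds (X := fun _ : Fin 4 => Fin 4 → v.adicCompletion k)
    (fun _ n y x => ∀ j, Valued.v (y j - x j) ≤ ε ^ n) (fun _ => hrow) x s hs

/-- Four matrices at once. -/
theorem exists_nat_nearQuad_subset_of_mem_nhds {ε : WithZero (Multiplicative ℤ)} (hε0 : ε ≠ 0) (hε1 : ε < 1)
    (x : Fin 4 → Matrix (Fin 4) (Fin 4) (v.adicCompletion k))
    (s : Set (Fin 4 → Matrix (Fin 4) (Fin 4) (v.adicCompletion k)))
    (hs : s ∈ 𝓝 x) :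
    ∃ n₀ : ℕ, ∀ n ≥ n₀, ∀ y, (∀ l i j, Valued.v (y l i j - x l i j) ≤ ε ^ n) → y ∈ s :=
  exists_nat_forall_near_of_mem_nhds (fun _ n y x => ∀ i j, Valued.v (y i j - x i j) ≤ ε ^ n)
    (fun _ => exists_nat_nearMat_subset_of_mem_nhds v hε0 hε1) x s hs

/-- **The local statement**: a continuous matrix expression in four matrix variables which is non-zero at
`(1, 1, 1, 1)` stays non-zero when every variable is entrywise within `ε ^ n` of `1`, for all `n ≥ n₀`. -/
theorem exists_nat_ne_zero_of_nearQuad {ε : WithZero (Multiplicative ℤ)} (hε0 : ε ≠ 0) (hε1 : ε < 1)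
    (Φ : (Fin 4 → Matrix (Fin 4) (Fin 4) (v.adicCompletion k)) → Matrix (Fin 4) (Fin 4) (v.adicCompletion k))
    (hΦ : Continuous Φ) (hΦ1 : Φ (fun _ => 1) ≠ 0) :
    ∃ n₀ : ℕ, ∀ n ≥ n₀, ∀ p, (∀ l i j, Valued.v (p l i j - (1 : Matrix (Fin 4) (Fin 4) (v.adicCompletion k)) i j) ≤ ε ^ n) →
      Φ p ≠ 0 := by
  have hs : {p : Fin 4 → Matrix (Fin 4) (Fin 4) (v.adicCompletion k) | Φ p ≠ 0} ∈
      𝓝 (fun _ => (1 : Matrix (Fin 4) (Fin 4) (v.adicCompletion k))) :=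
    (isOpen_ne.preimage hΦ).mem_nhds hΦ1
  exact exists_nat_nearQuad_subset_of_mem_nhds v hε0 hε1 _ _ hs

end Ball

/-! ### 3. A finite place above a prime `q` -/

section Place

variable (k : Type) [Field k] [NumberField k]

/-- A prime `q` lies in some finite place `v` of `k`: `(q : 𝓞 k) ∈ v` (lying over for `ℤ → 𝓞_k`). -/
theorem exists_heightOneSpectrum_natCast_mem (q : ℕ) (hq : q.Prime) :
    ∃ v : HeightOneSpectrum (𝓞 k), (q : 𝓞 k) ∈ v.asIdeal := by
  haveI : (Ideal.span {(q : ℤ)}).IsPrime :=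
    (Ideal.span_singleton_prime (by exact_mod_cast hq.ne_zero)).2 (Nat.prime_iff_prime_int.1 hq)
  have hker : RingHom.ker (algebraMap ℤ (𝓞 k)) = ⊥ :=
    (RingHom.injective_iff_ker_eq_bot (algebraMap ℤ (𝓞 k))).1 (RingHom.injective_int _)
  obtain ⟨Q, -, hQ, hQc⟩ := Ideal.exists_ideal_over_prime_of_isIntegral (Ideal.span {(q : ℤ)}) (⊥ : Ideal (𝓞 k))
    (by rw [← RingHom.ker_eq_comap_bot, hker]; exact bot_le)
  have hqQ : (q : 𝓞 k) ∈ Q := by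
    have : (q : ℤ) ∈ Q.comap (algebraMap ℤ (𝓞 k)) := by rw [hQc]; exact Ideal.mem_span_singleton_self _
    rw [Ideal.mem_comap] at this
    simpa using this
  have hne : Q ≠ ⊥ := by
    intro h
    rw [h, Ideal.mem_bot] at hqQ
    exact hq.ne_zero (by exact_mod_cast hqQ)
  exact ⟨⟨Q, hQ, hne⟩, hqQ⟩

/-- `|q|_v < 1` when `(q : 𝓞 k) ∈ v`. -/
theorem natSize_lt_one_of_mem (v : HeightOneSpectrum (𝓞 k)) {q : ℕ} (hq : (q : 𝓞 k) ∈ v.asIdeal) :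
    natSize k v q < 1 := by
  unfold natSize
  rw [HeightOneSpectrum.valuedAdicCompletion_eq_valuation' v]
  have h1 : ((q : ℕ) : k) = algebraMap (𝓞 k) k ((q : ℕ) : 𝓞 k) := by simp
  rw [h1, HeightOneSpectrum.valuation_lt_one_iff_dvd, Ideal.dvd_span_singleton]
  exact hq

end Place

/-! ### 4. The `v`-component of an adelic unitary and the level subgroup -/

section Component

variable {k : Type} [Field k] [NumberField k] (W : PlaneData k) (v : HeightOneSpectrum (𝓞 k))

/-- The matrix of the `v`-component is the entrywise `v`-component of the adelic matrix. -/
theorem finiteComponent_coe (g : GA W) :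
    ((GA.finiteComponent W v g : GL (Fin 4) (v.adicCompletion k)) : Matrix (Fin 4) (Fin 4) (v.adicCompletion k)) =
      (GA.mat W g).map (adComponentFin k v) := by
  ext i j
  rfl

/-- The `v`-component of an adele is the `v`-coordinate of its finite part. -/
theorem adComponentFin_eq_finPart_apply (z : Ad k) : adComponentFin k v z = finPart k z v := rfl

/-- Two adelic unitaries with the same finite part have the same `v`-component. -/
theorem finiteComponent_eq_of_finM_eq {x y : GA W} (h : finM k (GA.mat W x) = finM k (GA.mat W y)) :
    GA.finiteComponent W v x = GA.finiteComponent W v y := by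
  apply Units.ext
  rw [finiteComponent_coe, finiteComponent_coe]
  ext i j
  have hij : finPart k (GA.mat W x i j) = finPart k (GA.mat W y i j) := congrFun (congrFun h i) j
  simp only [Matrix.map_apply, adComponentFin_eq_finPart_apply, hij]

/-- The finite part of `GA.ofFinPart g` is that of `g`. -/
theorem finM_mat_ofFinPart_eq (g : GA W) : finM k (GA.mat W (GA.ofFinPart W g)) = finM k (GA.mat W g) := by
  rw [GA.mat_ofFinPart, finM_mixM]

/-- `GA.ofFinPart` does not change the `v`-component. -/
theorem finiteComponent_ofFinPart (g : GA W) :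
    GA.finiteComponent W v (GA.ofFinPart W g) = GA.finiteComponent W v g :=
  finiteComponent_eq_of_finM_eq W v (finM_mat_ofFinPart_eq W g)

/-- **Level elements are `v`-adically close to `1`**: for `a ∈ K(N)` every entry of the `v`-component of `a` is
within `|N|_v` of the corresponding entry of `1`. -/
theorem nearMat_finiteComponent_of_mem_levelK {N : ℕ} {a : GA W} (ha : a ∈ levelK W N) (i j : Fin 4) :
    Valued.v (((GA.finiteComponent W v a : GL (Fin 4) (v.adicCompletion k)) :
        Matrix (Fin 4) (Fin 4) (v.adicCompletion k)) i j - (1 : Matrix (Fin 4) (Fin 4) (v.adicCompletion k)) i j) ≤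
      natSize k v N := by
  obtain ⟨h1, -⟩ := (mem_levelK W N a).1 ha
  have hz : (GA.mat W a - 1) i j ∈ congrSet k N := h1 i j
  have hv : Valued.v (finPart k ((GA.mat W a - 1) i j) v) ≤ natSize k v N := hz.2 v
  have heq : ((GA.finiteComponent W v a : GL (Fin 4) (v.adicCompletion k)) :
        Matrix (Fin 4) (Fin 4) (v.adicCompletion k)) i j - (1 : Matrix (Fin 4) (Fin 4) (v.adicCompletion k)) i j =
      adComponentFin k v ((GA.mat W a - 1) i j) := by
    rw [GA.finiteComponent_apply, Matrix.sub_apply, map_sub]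
    congr 1
    by_cases hij : i = j
    · subst hij
      simp
    · simp [Matrix.one_apply_ne hij]
  rw [heq, adComponentFin_eq_finPart_apply]
  exact hv

end Component

end Summit.Ventures.HodgeRepro.Tier4.Line4

end
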